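import Summits.BirchSwinnertonDyer.BirchSwinnertonDyer.Theorems.KolyvaginRoadThreePTDevissageCofinite
import HarnessLib

/-!
# Dévissage of Milne I Thm. 4.10(b) — the SHRINKING LEMMA for the hypotheses `H¹_{𝓤_S^*}(K, X) = 0`

The dévissage `middleExact_of_extension` asks, at the finite set `S`, that no non-zero class of
`X ∈ {M₁^D, M₃^{DD}}` be ZERO at every place of `S` and UNRAMIFIED off `S`.  Every such class is unramified
everywhere off a fixed admissible `S₁ ⊆ S`; so if those classes form a FINITE set `U` and `Ш¹` vanishes on
`U` (a class of `U` vanishing at EVERY place is zero — e.g. `X ≅ μₚ`, `Ш¹(K, μₚ) = 0`), then the hypothesis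
holds for ALL finite `S` containing a finite `S₀ ⊇ S₁` (one detecting place per non-zero element of `U`):
`exists_finset_forall_eq_zero_of_finite`.  This reduces input E2 of the unipotent instance
(`middleExact_canonical_of_unipotentTwo`) to the FINITENESS of the classes of a trivial module of order `p`
unramified off `{v ∣ p}` (Silverman AEC X.4.3 / Kummer + finiteness of `K(S, p)`), and the passage to
every admissible `S` is `middleExact_of_middleExact_superset`.  Theorems only; no case of BSD.

References: [MilneADT2006] I Lemma 4.8, Thm. 4.10; [SilvermanAEC2009] Lemma X.4.3.
-/

noncomputable section

open Function NumberField IsDedekindDomain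
open scoped NumberField

universe u

set_option linter.dupNamespace false
set_option autoImplicit false

namespace Summit.BirchSwinnertonDyer.BirchSwinnertonDyer.Theorems.KolyvaginRoadThreePT

open Field
open Literature.NumberTheory.GaloisRepresentations
open Literature.NumberTheory.GaloisRepresentations.DiscreteGaloisModule (unramifiedSubgroup)

variable {K : Type u} [Field K] [NumberField K] {X : Type u} [AddCommGroup X] [TopologicalSpace X]
  [DiscreteTopology X]

/-- **Shrinking lemma.**  Let `S₁` be a finite set of places and `U` a FINITE set of classes of
`H¹(K, X)` containing every class that is zero on `S₁` and unramified off `S₁`, and such that a class of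
`U` vanishing at every place is zero.  Then there is a finite `S₀ ⊇ S₁` such that for every finite
`S ⊇ S₀`, every class zero on `S` and unramified off `S` is zero.  (For each non-zero `u ∈ U` put into
`S₀` one place where `u` does not vanish.) [cite: MilneADT2006, Ch. I §4, Lemma 4.8] -/
theorem exists_finset_forall_eq_zero_of_finite (ρ : DiscreteGaloisModule K X) (S₁ : Finset (Place K))
    (U : Set (galoisCohomology ρ 1)) (hUfin : U.Finite)
    (hU : ∀ y : galoisCohomology ρ 1,
      (∀ v ∈ S₁, galoisCohomology.localization ρ v 1 y = 0) →
      (∀ w : HeightOneSpectrum (𝓞 K), (Sum.inr w : Place K) ∉ S₁ →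
        galoisCohomology.localization ρ (Sum.inr w) 1 y ∈ unramifiedSubgroup (GaloisRep.toLocal w ρ) 1) →
      y ∈ U)
    (hSha : ∀ y ∈ U, (∀ v : Place K, galoisCohomology.localization ρ v 1 y = 0) → y = 0) :
    ∃ S₀ : Finset (Place K), S₁ ⊆ S₀ ∧ ∀ S : Finset (Place K), S₀ ⊆ S →
      ∀ y : galoisCohomology ρ 1,
        (∀ v ∈ S, galoisCohomology.localization ρ v 1 y = 0) →
        (∀ w : HeightOneSpectrum (𝓞 K), (Sum.inr w : Place K) ∉ S →
          galoisCohomology.localization ρ (Sum.inr w) 1 y ∈ unramifiedSubgroup (GaloisRep.toLocal w ρ) 1) →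
        y = 0 := by
  classical
  -- a detecting place for every non-zero element of `U`
  have hdet : ∀ u : galoisCohomology ρ 1, ∃ v : Place K,
      u ∈ U → u ≠ 0 → galoisCohomology.localization ρ v 1 u ≠ 0 := by
    intro u
    by_cases h : ∀ v : Place K, galoisCohomology.localization ρ v 1 u = 0
    · exact ⟨Sum.inl (Classical.arbitrary (InfinitePlace K)), fun hu hne => (hne (hSha u hu h)).elim⟩
    · simp only [not_forall] at h
      obtain ⟨v, hv⟩ := h
      exact ⟨v, fun _ _ => hv⟩
  choose d hd using hdet
  refine ⟨S₁ ∪ hUfin.toFinset.image d, Finset.subset_union_left, fun S hS y hyS hyur => ?_⟩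
  -- `y ∈ U`: the conditions at `S` imply those at `S₁`
  have hyU : y ∈ U := by
    refine hU y (fun v hv => hyS v (hS (Finset.mem_union_left _ hv))) (fun w hw => ?_)
    by_cases hwS : (Sum.inr w : Place K) ∈ S
    · rw [hyS _ hwS]
      exact zero_mem _
    · exact hyur w hwS
  by_contra hy0
  have hdS : d y ∈ S :=
    hS (Finset.mem_union_right _ (Finset.mem_image_of_mem d (hUfin.mem_toFinset.2 hyU)))
  exact hd y hyU hy0 (hyS _ hdS)

end Summit.BirchSwinnertonDyer.BirchSwinnertonDyer.Theorems.KolyvaginRoadThreePT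

end
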